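import Summits.RiemannHypothesis.RiemannHypothesis.Theorems.TiltedLandingLaw421R3FarPricing
import Summits.RiemannHypothesis.RiemannHypothesis.Theorems.TiltedLandingLaw421R3FarTwoPointM

/-!
# W-09 far branch · «FarPricingM» — (E) at ANY multiplicity: the imaginary part of the far remainder IS the far pull (C4 rh-idea-6 g43)

SUPPORT (K only; asserts no law; RH is NOT proved; ⟨33346⟩/⟨33347⟩ OPEN).  TWO imports, both landed: «FarPricing» (#1254: §2 the far
pull series `farPull_summable_continuousOn` / `farPull_conj` / `abs_im_one_div_sub_le` / `norm_sub_far_ge`, reused BY NAME) and «FarTwoPointM»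
(★M `RhW08.FarTwoPointM.farList_twoPoint_mult`: the complete far list of an `R/2`-isolated state of ANY multiplicity with the exact two-point
identity between any two non-zeros and its absolute summability).

CONTENT = #1254's ★★ `RhW08.FarPricing.im_lineRem_eq_farPull` with the simplicity hypothesis `f⁽ʲ⁺¹⁾(v) ≠ 0` DROPPED.
★★M `im_lineRem_eq_farPull_mult`: on a legal frame, for an `R/2`-isolated state `v` of multiplicity `m = ord_v f⁽ʲ⁾ ≥ 1`, at EVERY non-zero
`z` of `f⁽ʲ⁾` with `0 < Im z` in the slab `|Re z − Re v| ≤ R/3`:  `Im lineRem f j v R z = Σ'ᵢ Im 1/(z − aᵢ)` (absolutely summable) over ★M's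
list (far clause, completeness, multiplicity count and export, and the binder-free two-point clause re-exported, so one `obtain` serves a
whole certificate); at a child (`f⁽ʲ⁺¹⁾(z) = 0`) this reads `Σ'ᵢ Im 1/(z − aᵢ) = Im(−m·((z − v)⁻¹ + (z − v̄)⁻¹)) = −m·Q` — the value at which
102's `CertificatesExistSig` reads its datum (`G = −mult·farPairK v w`).
PROOF = #1254 §3 verbatim on ★M's list: `Φ := Im lineRem − pull` is locally constant on upper-half-plane non-zeros (the two-point clause,
imaginary parts), reflection-ODD (`im_lineRem_conj_mult`: the closed form `RhW08.FLinkGain.lineRem_eq` with `ord_{v̄} = ord_v` by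
`analyticOrderAt_conj_eq` and `levelField_conj`) and continuous across the real point `Re v` — so `Φ = 0`; the reference summability
`Σ 1/‖z − aᵢ‖² < ∞` is ★M's absolute clause at `(z, z)`.
No def, no twin of an importable statement (m = 1 is #1254's ★★, which stays the cited special case; tree facts by name: `lineRem_eq`,
`levelField_conj`, `levelField_child`, `iteratedDeriv_conj`, `analyticOrderAt_conj_eq`, `RhW08.Column.abs_im_le_of_level`,
`RhW08.GainSegment.differentiableAt_lineRem`, `RhW08.ClusterQ.R_pos_of_engine`, and all of #1254 §2).
-/

noncomputable section

namespace RhW08.FarPricingM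

open Complex Filter Topology Set
open scoped ComplexConjugate
open RhW08.Round1 RhW08.StSwap RhW08.Round2 RhW08.QuadW
open RhW08.SealSwap (PBot)
open RhW08.SealSwapQ RhW08.RateSplit RhW08.IsolatedTilt RhW08.FarStep RhW08.BurgersRate RhW08.PurseP RhW08.BurgersRateG3
open RhIdea6.G17.W07C7 RhIdea6.G17.W07C7.Rev6 RhIdea6.G18.W07C8.Law421BirthS RhIdea6.G19.W07C11.Seam
open RhIdea6.G20.W07C12.Frac RhIdea6.G20.W07C12.StColP RhW07.C12.FieldSplit RhIdea6.G21.W07C13.TentMax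
open RhW07.C14.TwoSided RhW07.C14.Classes RhW07.C14.Lineage RhW07.C14.Booking
open RhW08.FLink RhW08.FLinkGain RhW08.FLinkGainSeam
open RhW08.GainTwoPoint RhW08.FarPricing RhW08.FarTwoPointM

/-- (K) reflection-oddness of `Im lineRem` at ANY multiplicity (the closed form `lineRem_eq`; `f` real, `ord_{v̄} = ord_v`). -/
theorem im_lineRem_conj_mult {η : ℝ} {f : ℂ → ℂ} {x₀ s hmax R Hs : ℝ} {B : ℕ} (hE : EngineHyps5 2 η f x₀ s hmax R Hs B)
    {j : ℕ} {v : ℂ} (hFv : iteratedDeriv j f v = 0) (hv0 : 0 < v.im)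
    (hiso : ∀ z : ℂ, iteratedDeriv j f z = 0 → |z.re - v.re| < R / 2 → z = v ∨ z = conj v) (p : ℂ) :
    (lineRem f j v R (conj p)).im = -(lineRem f j v R p).im := by
  have hR : 0 < R := RhW08.ClusterQ.R_pos_of_engine hE
  have hFcv : iteratedDeriv j f (conj v) = 0 := by rw [iteratedDeriv_conj hE, hFv, map_zero]
  have hc : lineRem f j v R (conj p) = conj (lineRem f j v R p) := by
    rw [lineRem_eq hiso hFv hFcv hR hv0, lineRem_eq hiso hFv hFcv hR hv0, analyticOrderAt_conj_eq hE, levelField_conj hE]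
    have h1 : (conj p - v)⁻¹ = conj ((p - conj v)⁻¹) := by rw [map_inv₀, map_sub, conj_conj]
    have h2 : (conj p - conj v)⁻¹ = conj ((p - v)⁻¹) := by rw [map_inv₀, map_sub]
    rw [h1, h2, map_sub, map_add, map_mul, map_mul, Complex.conj_natCast]
    ring
  rw [hc, conj_im]

/-- ★★M (K) **THE IMAGINARY PART OF THE FAR REMAINDER IS THE FAR PULL — at any multiplicity** of the `R/2`-isolated state `v`
(#1254's ★★ without `f⁽ʲ⁺¹⁾ v ≠ 0`): ★M's far list with far clause, completeness, multiplicity count / export and the binder-free two-point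
clause, AND for every non-zero `z` of `f⁽ʲ⁾` with `0 < Im z`, `|Re z − Re v| ≤ R/3`: the pull is summable and equals `Im lineRem(z)`; at a child
it is `Im(−m·K_v(z))`, `m = ord_v f⁽ʲ⁾`.  Proof: #1254 §3 (constancy · reflection-oddness · continuity across the real point `Re v`). -/
theorem im_lineRem_eq_farPull_mult {η : ℝ} {f : ℂ → ℂ} {x₀ s hmax R Hs : ℝ} {B : ℕ} (hE : EngineHyps5 2 η f x₀ s hmax R Hs B)
    {j : ℕ} {v : ℂ} (hFv : iteratedDeriv j f v = 0) (hv0 : 0 < v.im)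
    (hiso : ∀ z : ℂ, iteratedDeriv j f z = 0 → |z.re - v.re| < R / 2 → z = v ∨ z = conj v) :
    ∃ (ι : Type) (a : ι → ℂ), (∀ i, iteratedDeriv j f (a i) = 0 ∧ R / 2 ≤ |(a i).re - v.re|) ∧
      (∀ z, iteratedDeriv j f z = 0 → z ≠ v → z ≠ conj v → ∃ i, z = a i) ∧
      (∀ c, c ≠ v → c ≠ conj v → {i | a i = c}.ncard = analyticOrderNatAt (iteratedDeriv j f) c) ∧
      (∀ g : ℂ → ℝ, Summable (fun i ↦ g (a i)) → HasSum (fun c : ℂ ↦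
        (if c = v ∨ c = conj v then (0 : ℝ) else (analyticOrderNatAt (iteratedDeriv j f) c : ℝ)) * g c) (∑' i, g (a i))) ∧
      (∀ z z' : ℂ, iteratedDeriv j f z ≠ 0 → iteratedDeriv j f z' ≠ 0 →
        Summable (fun i ↦ 1 / (‖z - a i‖ * ‖z' - a i‖)) ∧
        Summable (fun i ↦ (1 / (z - a i) - 1 / (z' - a i))) ∧
          lineRem f j v R z - lineRem f j v R z' = ∑' i, (1 / (z - a i) - 1 / (z' - a i))) ∧
      ∀ z : ℂ, iteratedDeriv j f z ≠ 0 → 0 < z.im → |z.re - v.re| ≤ R / 3 →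
        Summable (fun i ↦ (1 / (z - a i)).im) ∧ (lineRem f j v R z).im = ∑' i, (1 / (z - a i)).im ∧
          (iteratedDeriv (j + 1) f z = 0 →
            ∑' i, (1 / (z - a i)).im = (-(analyticOrderNatAt (iteratedDeriv j f) v : ℂ) * ((z - v)⁻¹ + (z - conj v)⁻¹)).im) := by
  obtain ⟨ι, a, hfar, hcomplete, hcount, hexp0, htwo⟩ := farList_twoPoint_mult hE hFv hv0 hiso
  have hFcv : iteratedDeriv j f (conj v) = 0 := by rw [iteratedDeriv_conj hE, hFv, map_zero]
  have hR : 0 < R := RhW08.ClusterQ.R_pos_of_engine hE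
  have hHs : 0 ≤ Hs := hE.2.2.2.2.2.2.2.1
  -- the export with weights `m = 1`, against the reflection-symmetric multiplicity `n`
  set n : ℂ → ℝ := fun c ↦ (if c = v ∨ c = conj v then (0 : ℝ) else (analyticOrderNatAt (iteratedDeriv j f) c : ℝ)) with hndef
  have hexp' : ∀ g : ℂ → ℝ, Summable (fun i ↦ g (a i)) → HasSum (fun c : ℂ ↦ n c * g c) (∑' i, g (a i)) := hexp0
  have hn : ∀ c, n (conj c) = n c := by
    intro c
    have h1 : (conj c = v ∨ conj c = conj v) ↔ (c = v ∨ c = conj v) := by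
      constructor
      · rintro (h | h)
        · exact Or.inr (by rw [← h, conj_conj])
        · exact Or.inl (by simpa using congrArg conj h)
      · rintro (h | h)
        · exact Or.inr (by rw [h])
        · exact Or.inl (by rw [h, conj_conj])
    simp only [hndef, h1, analyticOrderNatAt, analyticOrderAt_conj_eq hE]
  refine ⟨ι, a, hfar, hcomplete, hcount, hexp', htwo, ?_⟩
  intro z hz hzim hzre
  have hza : ∀ i, z ≠ a i := fun i h ↦ hz (by rw [h]; exact (hfar i).1)
  have hne : iteratedDeriv j f ≠ 0 := fun h ↦ hz (by rw [h]; rfl)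
  have hstripa : ∀ i, |(a i).im| ≤ Hs := fun i ↦ RhW08.Column.abs_im_le_of_level hE hne (hfar i).1
  have hfar' : ∀ i, R / 2 ≤ |(a i).re - v.re| := fun i ↦ (hfar i).2
  -- reference summability `Σ 1/‖z − aᵢ‖² < ∞`: ★ at the pair `(z, z)`
  have hsum2 : Summable (fun i ↦ 1 / (‖z - a i‖ * ‖z - a i‖)) := (htwo z z hz hz).1
  -- the bounded slab piece `S ∋ z`, containing the ball `‖p − Re v‖ < r` together with its reflection
  set x : ℂ := (v.re : ℂ) with hxdef
  set r : ℝ := min (R / 3) (v.im / 2) with hrdef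
  have hr0 : 0 < r := lt_min (by linarith) (by linarith)
  have hrR : r ≤ R / 3 := min_le_left _ _
  have hrv : r ≤ v.im / 2 := min_le_right _ _
  set H : ℝ := max |z.im| r with hHdef
  set D : ℝ := ‖z - x‖ + r with hDdef
  have hH0 : 0 ≤ H := (abs_nonneg _).trans (le_max_left _ _)
  set S : Set ℂ := {p : ℂ | |p.re - v.re| ≤ R / 3 ∧ |p.im| ≤ H ∧ ‖z - p‖ ≤ D} with hSdef
  obtain ⟨hsumS, hcontS⟩ :=
    farPull_summable_continuousOn (S := S) hR hHs hH0 hfar' hstripa hza hsum2 (fun p hp ↦ hp)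
  have hzS : z ∈ S := ⟨hzre, le_max_left _ _, by rw [sub_self, norm_zero, hDdef]; positivity⟩
  have hvx : v - x = ((v.im : ℝ) : ℂ) * I := Complex.ext (by simp [hxdef]) (by simp [hxdef])
  have hcvx : conj v - x = -(((v.im : ℝ) : ℂ) * I) := Complex.ext (by simp [hxdef]) (by simp [hxdef])
  have hnvx : ‖v - x‖ = v.im := by
    rw [hvx, norm_mul, Complex.norm_real, Complex.norm_I, mul_one, Real.norm_eq_abs, abs_of_pos hv0]
  have hncvx : ‖conj v - x‖ = v.im := by
    rw [hcvx, norm_neg, norm_mul, Complex.norm_real, Complex.norm_I, mul_one, Real.norm_eq_abs, abs_of_pos hv0]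
  have hball : ∀ p : ℂ, ‖p - x‖ < r → p ∈ S ∧ conj p ∈ S ∧ iteratedDeriv j f p ≠ 0 ∧ p ≠ v ∧ p ≠ conj v := by
    intro p hp
    have hre : |p.re - v.re| ≤ R / 3 := by
      have h := Complex.abs_re_le_norm (p - x)
      rw [Complex.sub_re, hxdef, Complex.ofReal_re] at h
      linarith
    have him : |p.im| ≤ H := by
      have h := Complex.abs_im_le_norm (p - x)
      rw [Complex.sub_im, hxdef, Complex.ofReal_im, sub_zero] at h
      exact le_max_of_le_right (h.trans hp.le)
    have hdist : ‖z - p‖ ≤ D := by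
      have h := norm_sub_le_norm_sub_add_norm_sub z x p
      rw [norm_sub_rev x p] at h
      rw [hDdef]
      linarith
    have hpv : p ≠ v := fun h ↦ by rw [h, hnvx] at hp; linarith
    have hpcv : p ≠ conj v := fun h ↦ by rw [h, hncvx] at hp; linarith
    have hp0 : iteratedDeriv j f p ≠ 0 := fun h0 ↦ (hiso p h0 (by linarith)).elim hpv hpcv
    have hcdist : ‖z - conj p‖ ≤ D := by
      have h := norm_sub_le_norm_sub_add_norm_sub z x (conj p)
      have hxc : ‖x - conj p‖ = ‖p - x‖ := by
        rw [← Complex.norm_conj (x - conj p), map_sub, Complex.conj_conj, hxdef, Complex.conj_ofReal, norm_sub_rev]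
      rw [hxc] at h
      rw [hDdef]
      linarith
    refine ⟨⟨hre, him, hdist⟩, ⟨?_, ?_, hcdist⟩, hp0, hpv, hpcv⟩
    · rwa [Complex.conj_re]
    · rwa [Complex.conj_im, abs_neg]
  -- (A) `Φ` is constant on the upper half of the ball (★'s two-point identity, imaginary part)
  have hA : ∀ p : ℂ, ‖p - x‖ < r → 0 < p.im →
      (lineRem f j v R p).im - ∑' i, (1 / (p - a i)).im = (lineRem f j v R z).im - ∑' i, (1 / (z - a i)).im := by
    intro p hp hpim
    obtain ⟨hpS, -, hp0, -, -⟩ := hball p hp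
    obtain ⟨hsd, hid⟩ := (htwo z p hz hp0).2
    have h1 : HasSum (fun i ↦ (1 / (z - a i) - 1 / (p - a i)).im) (lineRem f j v R z - lineRem f j v R p).im := by
      have h := hsd.hasSum
      rw [← hid] at h
      exact ((Complex.hasSum_iff _ _).1 h).2
    have h2 : HasSum (fun i ↦ (1 / (z - a i) - 1 / (p - a i)).im)
        (∑' i, (1 / (z - a i)).im - ∑' i, (1 / (p - a i)).im) := by
      have h := (hsumS z hzS).hasSum.sub (hsumS p hpS).hasSum
      simpa only [Complex.sub_im] using h
    have h3 := h1.unique h2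
    rw [Complex.sub_im] at h3
    linarith
  -- (B) `Φ` is reflection-odd on the ball
  have hB : ∀ p : ℂ, ‖p - x‖ < r →
      (lineRem f j v R (conj p)).im - ∑' i, (1 / (conj p - a i)).im
        = -((lineRem f j v R p).im - ∑' i, (1 / (p - a i)).im) := by
    intro p hp
    obtain ⟨hpS, hcpS, -, -, -⟩ := hball p hp
    rw [im_lineRem_conj_mult hE hFv hv0 hiso, farPull_conj hn hexp' (hsumS p hpS) (hsumS _ hcpS)]
    ring
  -- (C) `Φ` is continuous on the ball
  have hC : ContinuousOn (fun p ↦ (lineRem f j v R p).im - ∑' i, (1 / (p - a i)).im) (Metric.ball x r) := by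
    have hsub : Metric.ball x r ⊆ S := fun p hp ↦ (hball p (mem_ball_iff_norm.1 hp)).1
    refine ContinuousOn.sub (fun p hp ↦ ?_) (hcontS.mono hsub)
    obtain ⟨-, -, hp0, hpv, hpcv⟩ := hball p (mem_ball_iff_norm.1 hp)
    exact (Complex.continuous_im.continuousAt.comp
      (RhW08.GainSegment.differentiableAt_lineRem hE hiso hFv hv0 hp0 hpv hpcv).continuousAt).continuousWithinAt
  -- (D) the two one-sided limits at the real point `x = Re v`
  set Φ : ℂ → ℝ := fun p ↦ (lineRem f j v R p).im - ∑' i, (1 / (p - a i)).im with hΦdef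
  set t : ℕ → ℝ := fun k ↦ r / 2 * (1 / ((k : ℝ) + 1)) with htdef
  have ht0 : ∀ k, 0 < t k := fun k ↦ by rw [htdef]; positivity
  have htr : ∀ k, t k < r := by
    intro k
    have hk : 1 / ((k : ℝ) + 1) ≤ 1 := by
      rw [div_le_one (by positivity)]
      linarith [(Nat.cast_nonneg k : (0 : ℝ) ≤ k)]
    have : t k ≤ r / 2 := by
      rw [htdef]
      nlinarith
    linarith
  have htt : Tendsto t atTop (𝓝 0) := by
    have h := (tendsto_const_nhds (x := r / 2)).mul (tendsto_one_div_add_atTop_nhds_zero_nat (𝕜 := ℝ))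
    rw [mul_zero] at h
    exact h
  set q : ℕ → ℂ := fun k ↦ x + ((t k : ℝ) : ℂ) * I with hqdef
  have hq : ∀ k, ‖q k - x‖ < r ∧ 0 < (q k).im := by
    intro k
    have hqx : q k - x = ((t k : ℝ) : ℂ) * I := by rw [hqdef]; ring
    refine ⟨?_, ?_⟩
    · rw [hqx, norm_mul, Complex.norm_real, Complex.norm_I, mul_one, Real.norm_eq_abs, abs_of_pos (ht0 k)]
      exact htr k
    · have : (q k).im = t k := by simp [hqdef, hxdef]
      rw [this]
      exact ht0 k
  have hqt : Tendsto q atTop (𝓝 x) := by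
    have h := (((Complex.continuous_ofReal.tendsto 0).comp htt).mul_const I).const_add x
    simpa using h
  have hqt' : Tendsto (fun k ↦ conj (q k)) atTop (𝓝 x) := by
    have h := (Complex.continuous_conj.tendsto x).comp hqt
    have hxx : conj x = x := by rw [hxdef, Complex.conj_ofReal]
    rw [hxx] at h
    exact h
  have hxball : Metric.ball x r ∈ 𝓝 x := Metric.isOpen_ball.mem_nhds (Metric.mem_ball_self hr0)
  have hΦx : ContinuousAt Φ x := hC.continuousAt hxball
  have hlim1 : Tendsto (fun k ↦ Φ (q k)) atTop (𝓝 (Φ x)) := hΦx.tendsto.comp hqt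
  have hlim2 : Tendsto (fun k ↦ Φ (conj (q k))) atTop (𝓝 (Φ x)) := hΦx.tendsto.comp hqt'
  have hconst1 : (fun k ↦ Φ (q k)) = fun _ ↦ Φ z := funext fun k ↦ hA (q k) (hq k).1 (hq k).2
  have hconst2 : (fun k ↦ Φ (conj (q k))) = fun _ ↦ -Φ z := by
    funext k
    show (lineRem f j v R (conj (q k))).im - ∑' i, (1 / (conj (q k) - a i)).im
      = -((lineRem f j v R z).im - ∑' i, (1 / (z - a i)).im)
    rw [← hA (q k) (hq k).1 (hq k).2]
    exact hB (q k) (hq k).1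
  rw [hconst1] at hlim1
  rw [hconst2] at hlim2
  have h1 : Φ x = Φ z := tendsto_nhds_unique hlim1 tendsto_const_nhds
  have h2 : Φ x = -Φ z := tendsto_nhds_unique hlim2 tendsto_const_nhds
  have hE' : (lineRem f j v R z).im = ∑' i, (1 / (z - a i)).im := by
    have hΦz : Φ z = 0 := by linarith
    exact sub_eq_zero.1 hΦz
  refine ⟨hsumS z hzS, hE', fun hz' ↦ ?_⟩
  rw [← hE', lineRem_eq hiso hFv hFcv hR hv0 z, levelField_child hz', analyticOrderAt_conj_eq hE]
  unfold analyticOrderNatAt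
  congr 1
  ring

end RhW08.FarPricingM

end
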